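/-
Copyright (c) 2026 the pub-hodgecm-mathlib formalisation cell (harness21).  Prover seat hodgecm-mathlib-R90-C131-p05 (g2), R90-TF SLAB section S4
«Ch13.1–2» (base R90-C131), h413 = `stmt-HodgeConjecture-24833`; brick (NORM-RAT) of the S4 dealer K2E2-plan (g7) (S4-R26 (2), R90 bus
2026-09-05T00:28:36Z) = the named gap A5 of R90-C131-p03 (g2)'s HEADS-TWIF sheet.
-/
import Summits.HodgeConjecture.HodgeConjecture.Theorems.R90S4TwistedTransferDefs        -- ★ `IsEpsRegularAt`; brings ★ `IsEpsNormPair`, `epsLoc`, `GtLoc`, `twistLocal`, `formLocal`, ★ `Ch4Sec10` (`unitaryTwist`, `epsNorm`)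
import Summits.HodgeConjecture.HodgeConjecture.Theorems.R90S4SplitFormHermitian          -- ★ `splitFormGL`, `coe_splitFormGL` (`rfl`); brings `splitForm`
import Literature.NumberTheory.Automorphic.LocalHermitianFormsRankThreeCongruence        -- ★ `exists_isUnit_formCongr_eq_smul_antidiag_three` (Jacobowitz: every ternary `G ≅ a • Φ₃` at a non-split `v`)
import Literature.NumberTheory.Automorphic.UnitaryGroupLevelTransport                    -- ★ `unitaryGroupOfForm_smul_of_isUnit` (`U(a • H) = U(H)`)
import Literature.NumberTheory.Automorphic.LocalUnitaryGroupCongr                        -- ★ `local_eq_unitaryGroupOfForm_map`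
import Literature.NumberTheory.Automorphic.QuadraticLocalBaseChange                      -- ★ `conjLocal_algebraMap`
import HarnessLib

/-!
# R90-TF · S4 — (NORM-RAT) `R90S4EpsRegularHasNorm`: at a non-split place EVERY `δ ∈ G̃_v = GL₃(L ⊗ L⁺_v)` HAS A NORM in the quasi-split
# `U(Φ₃)(L⁺_v)` — in particular every ε-regular `δ` (Rogawski 1990, Prop. 3.11.1 (a)(c) p. 34)

Cell `hodgecm-mathlib`, crux H413 = `stmt-HodgeConjecture-24833`, route of record `HCCMUnconditional`; R90-TF section S4 (Rogawski Ch. 13.1–2, base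
`R90-C131`), seat R90-C131-p05 (g2); the named gap A5 (NORM-RAT) of the T-WIF road for the (1D-CT)∕(W-NP) socket of S4 FILE C (R90-C131-p03's sheet
`HEADS-TWIF-tube.md`: COVER-ε needs «every ε-regular-semisimple `δ ∈ GL₃(E_v)` has a norm in `U(Φ₃)(L⁺_v)`»).  THEOREMS ONLY (no `def`, no `instance`, no
notation, no named-fact hypothesis, no `sorry`; default heartbeats); lane `--supports stmt-HodgeConjecture-24833 --as helper` (count-neutral).

THE MATHEMATICS.  Print (Prop. 3.11.1, p. 34: «the norm map defines a bijection between `𝒪_{ε-st}(G̃)` and `𝒪_{st}(G)`») deduces the EXISTENCE of a norm from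
Kottwitz's theorem (Thm. 3.2.1: a stable class defined over `F` in a quasi-split group with simply connected derived group has a rational point).  Here an
EXPLICIT hermitian form does it, over ANY commutative ring `R` with an involution `σ` and a `σ`-hermitian `Φ ∈ GL_n(R)` (§1): write `g* := (σg)ᵀ`,
`ε(g) = Φ⁻¹ g*⁻¹ Φ` (★ `unitaryTwist`), `γ₀ := N(δ) = δ ε(δ) = δ Φ⁻¹ δ*⁻¹ Φ` (★ `epsNorm`) and `M := Φ δ⁻¹`.  Two identities:
(I1) `γ₀* · M · γ₀ = M`;  (I2) `M* = M γ₀`.  Hence for every scalar `c ∈ R` the matrix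
**`Ψ_c := M · (c·1 + σ(c)·γ₀) = c·M + σ(c)·M*`** is `σ`-HERMITIAN and **`γ₀ ∈ U(Ψ_c)`** (`γ₀* Ψ_c γ₀ = Ψ_c`, since `c + σ(c)γ₀` commutes with `γ₀`):
`N(δ)` preserves the hermitian form `Ψ_c` (§1 `epsNorm_mem_unitaryGroupOfForm_normForm`, `normForm_isHermitian`).  At a place `v` of `L⁺` NON-SPLIT in the CM
field `L` (`K = L ⊗ L⁺_v` a field), `det(c·1 + σ(c)·γ₀) = (−σc)³ · χ_{γ₀}(−c∕σ(c))` and the four scalars `c_k = k + θ` (`k = 0,1,2,3`, `σθ = −θ ≠ 0`) have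
four DISTINCT ratios `−c_k∕σ(c_k)`, not all roots of the cubic `χ_{γ₀}` — so some `Ψ_c` is NON-DEGENERATE (§2 `exists_det_add_smul_ne_zero`); Jacobowitz's
classification (★ `exists_isUnit_formCongr_eq_smul_antidiag_three`: `ᵗ(σT) Ψ_c T = a · Φ₃`, `a` a `σ`-fixed unit) then conjugates `γ₀` into
`U(a·Φ₃) = U(Φ₃)` (★ `unitaryGroupOfFormCongrOfEq`, ★ `unitaryGroupOfForm_smul_of_isUnit`): `γ := T⁻¹ γ₀ T ∈ U(Φ₃)(L⁺_v)` is `G̃_v`-conjugate to `N(δ)`, i.e.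
`IsEpsNormPair … δ γ` (§3).  ε-REGULARITY IS NOT USED: the head `exists_isEpsNormPair_splitFormGL` is «`hns` ⇒ every `δ ∈ G̃_v` has a norm in `U(Φ₃)(L⁺_v)`»
(semisimple or not), and the dealt shape `exists_isEpsNormPair_of_isEpsRegularAt` is its restriction.  No Hilbert 90, no Galois cohomology, no torus census.
WHY `hns`: the field structure of `L ⊗ L⁺_v` is used (at a split `v` the statement is still true — `G̃_v = GL₃ × GL₃` with the swap — but is another file).

* §1 (generic, `R` commutative with `σ`, `Φ` hermitian, `σ` involutive): `coe_inv_glTransposeInv_map` (`((σX)ᵀ⁻¹)⁻¹ = (σX)ᵀ`, `rfl`), `glTransposeInv_map_eq_inv_of_isHermitian`,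
  `glTransposeInv_map_glTransposeInv_map`, `inv_glTransposeInv_map_epsNorm_mul` (I1), `inv_glTransposeInv_map_formMul` (I2), `normForm_isHermitian`,
  `epsNorm_mem_unitaryGroupOfForm_normForm`.
* §2 (over a field of characteristic `0`): `exists_det_add_smul_ne_zero` — some `c` makes `c·1 + σ(c)·γ₀` invertible.
* §3 HEADS: **`exists_isEpsNormPair_splitFormGL`** (every `δ`), **`exists_isEpsNormPair_of_isEpsRegularAt`** (the dealt (NORM-RAT) shape).

HONEST LABEL: HC_CM is proved only modulo the 7 printed citations (2 remaining named inputs: hLiu418 = `stmt-HodgeConjecture-24832`, h413 = `stmt-HodgeConjecture-24833`)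
until rung 0 closes; this ★ helper discharges the named gap (NORM-RAT) of the T-WIF road behind the (W-NP) socket of S4 FILE C and closes no socket by itself;
REL ≠ ★ ≠ BUILT; count-neutral.

## References
* [Rogawski1990] J. D. Rogawski, *Automorphic Representations of Unitary Groups in Three Variables*, Ann. of Math. Stud. 123 (1990), §3.10 p. 33, §3.11
  Prop. 3.11.1 (a)(c) p. 34 (materialised text p0037–p0038), §4.10 p. 57.
* [Jacobowitz1962] R. Jacobowitz, *Hermitian forms over local fields*, Amer. J. Math. 84 (1962), §3 Thm. 3.1.
* [PlatonovRapinchuk1994] V. Platonov, A. Rapinchuk, *Algebraic Groups and Number Theory* (1994), §2.3 (unitary groups of congruent forms), §6.5.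
-/

set_option autoImplicit false
-- the mandated namespace repeats the single-problem summit's segment (`HodgeConjecture.HodgeConjecture`)
set_option linter.dupNamespace false

noncomputable section

open NumberField IsDedekindDomain Matrix
open scoped MatrixGroups
open Literature.NumberTheory.Automorphic Literature.NumberTheory.Automorphic.UnitaryGroup
open Literature.NumberTheory.Rogawski1990 Literature.NumberTheory.Rogawski1990.Ch4Sec10
open Literature.NumberTheory.GaloisRepresentations (glTransposeInv coe_glTransposeInv_apply)
open Summit.HodgeConjecture.HodgeConjecture.Cruxes.H413.K2E1GlobalTestFunctionsTwisted (formLocal twistLocal)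
open Summit.HodgeConjecture.HodgeConjecture.Cruxes.H413.F0P3InnerFormClassificationV6 (splitForm)

namespace Summit.HodgeConjecture.HodgeConjecture.R90.S4

/-! ## §1 Generic: the hermitian form `Ψ_c = Φ δ⁻¹ (c + σ(c) N(δ))` preserved by `N(δ)` -/

section Generic

variable {R : Type*} [CommRing R] [TopologicalSpace R] {n : Type*} [Fintype n] [DecidableEq n] (σ : R →+* R) (Φ : GL n R)

/-- The conjugate transpose as a `GL_n(R)`-element: `((σX)ᵀ⁻¹)⁻¹ = (σX)ᵀ` on matrices (`rfl` for the tree's ★ `glTransposeInv`). [folklore] -/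
theorem coe_inv_glTransposeInv_map (X : GL n R) :
    (((glTransposeInv n R (Matrix.GeneralLinearGroup.map σ X))⁻¹ : GL n R) : Matrix n n R) = ((X : Matrix n n R).map σ)ᵀ := rfl

/-- For a `σ`-HERMITIAN `Φ` (`(σΦ)ᵀ = Φ`): `(σΦ)ᵀ⁻¹ = Φ⁻¹` in `GL_n(R)`. [cite: PlatonovRapinchuk1994, §2.3] -/
theorem glTransposeInv_map_eq_inv_of_isHermitian (hΦ : (((Φ : GL n R) : Matrix n n R).map σ)ᵀ = Φ) :
    glTransposeInv n R (Matrix.GeneralLinearGroup.map σ Φ) = Φ⁻¹ := by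
  rw [← _root_.inv_inj, inv_inv]
  exact Units.ext (by rw [coe_inv_glTransposeInv_map, hΦ])

/-- For an INVOLUTION `σ`: `X ↦ (σX)ᵀ⁻¹` is an involution of `GL_n(R)`. [folklore] -/
theorem glTransposeInv_map_glTransposeInv_map (hσ : ∀ x, σ (σ x) = x) (X : GL n R) :
    glTransposeInv n R (Matrix.GeneralLinearGroup.map σ (glTransposeInv n R (Matrix.GeneralLinearGroup.map σ X))) = X := by
  rw [← _root_.inv_inj]
  refine Units.ext ?_
  rw [coe_inv_glTransposeInv_map]
  -- `(σ ((σX)ᵀ⁻¹))ᵀ = X⁻¹`: the matrix of `(σX)ᵀ⁻¹` is `((σX)⁻¹)ᵀ`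
  rw [coe_glTransposeInv_apply, Matrix.transpose_map, Matrix.transpose_transpose, ← map_inv]
  change (((X⁻¹ : GL n R) : Matrix n n R).map σ).map σ = ((X⁻¹ : GL n R) : Matrix n n R)
  rw [Matrix.map_map]
  ext i j
  simp only [Matrix.map_apply, Function.comp_apply, hσ]

/-- **(I1) `N(δ)* · (Φ δ⁻¹) · N(δ) = Φ δ⁻¹`** (`X* = (σX)ᵀ`, `N(δ) = δ ε(δ)`, `ε(g) = Φ⁻¹ g*⁻¹ Φ`; `σ` involutive, `Φ` hermitian) — pure group algebra in
`GL_n(R)`: `N(δ)* = Φ δ⁻¹ Φ⁻¹ δ*` and `δ* Φ δ⁻¹ · δ Φ⁻¹ δ*⁻¹ Φ = Φ`. [cite: Rogawski1990, §3.10 p. 33; §3.11 p. 34] -/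
theorem inv_glTransposeInv_map_epsNorm_mul (hσ : ∀ x, σ (σ x) = x) (hΦ : (((Φ : GL n R) : Matrix n n R).map σ)ᵀ = Φ) (δ : GL n R) :
    (glTransposeInv n R (Matrix.GeneralLinearGroup.map σ (epsNorm (unitaryTwist σ Φ) δ)))⁻¹ * (Φ * δ⁻¹) *
        epsNorm (unitaryTwist σ Φ) δ = Φ * δ⁻¹ := by
  set s : GL n R →* GL n R := (glTransposeInv n R).toMonoidHom.comp (Matrix.GeneralLinearGroup.map σ) with hs
  have hs_apply : ∀ X : GL n R, glTransposeInv n R (Matrix.GeneralLinearGroup.map σ X) = s X := fun X => rfl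
  have hsΦ : s Φ = Φ⁻¹ := by rw [← hs_apply]; exact glTransposeInv_map_eq_inv_of_isHermitian σ Φ hΦ
  have hss : ∀ X, s (s X) = X := fun X => by rw [← hs_apply, ← hs_apply]; exact glTransposeInv_map_glTransposeInv_map σ hσ X
  have hN : epsNorm (unitaryTwist σ Φ) δ = δ * (Φ⁻¹ * s δ * Φ) := rfl
  rw [hs_apply, hN, map_mul, map_mul, map_mul, map_inv, hsΦ, hss, inv_inv]
  group

/-- **(I2) `(Φ δ⁻¹)* = Φ δ⁻¹ · N(δ)`** (both sides equal `δ*⁻¹ Φ`). [cite: Rogawski1990, §3.10 p. 33; §3.11 p. 34] -/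
theorem inv_glTransposeInv_map_formMul (hΦ : (((Φ : GL n R) : Matrix n n R).map σ)ᵀ = Φ) (δ : GL n R) :
    (glTransposeInv n R (Matrix.GeneralLinearGroup.map σ (Φ * δ⁻¹)))⁻¹ = Φ * δ⁻¹ * epsNorm (unitaryTwist σ Φ) δ := by
  set s : GL n R →* GL n R := (glTransposeInv n R).toMonoidHom.comp (Matrix.GeneralLinearGroup.map σ) with hs
  have hs_apply : ∀ X : GL n R, glTransposeInv n R (Matrix.GeneralLinearGroup.map σ X) = s X := fun X => rfl
  have hsΦ : s Φ = Φ⁻¹ := by rw [← hs_apply]; exact glTransposeInv_map_eq_inv_of_isHermitian σ Φ hΦ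
  have hN : epsNorm (unitaryTwist σ Φ) δ = δ * (Φ⁻¹ * s δ * Φ) := rfl
  rw [hs_apply, hN, map_mul, map_inv, hsΦ]
  group

/-- **The form `Ψ_c = Φ δ⁻¹ · (c·1 + σ(c)·N(δ))` is `σ`-HERMITIAN** (`σ` involutive, `Φ` hermitian): by (I2), `Ψ_c = c·M + σ(c)·M*` with `M = Φ δ⁻¹`, and
`(c·M + σ(c)·M*)* = σ(c)·M* + c·M`. [cite: Rogawski1990, §3.11 p. 34] [cite: PlatonovRapinchuk1994, §2.3] -/
theorem normForm_isHermitian (hσ : ∀ x, σ (σ x) = x) (hΦ : (((Φ : GL n R) : Matrix n n R).map σ)ᵀ = Φ) (δ : GL n R) (c : R) :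
    ((((Φ * δ⁻¹ : GL n R) : Matrix n n R) *
        (c • (1 : Matrix n n R) + σ c • ((epsNorm (unitaryTwist σ Φ) δ : GL n R) : Matrix n n R))).map σ)ᵀ =
      ((Φ * δ⁻¹ : GL n R) : Matrix n n R) *
        (c • (1 : Matrix n n R) + σ c • ((epsNorm (unitaryTwist σ Φ) δ : GL n R) : Matrix n n R)) := by
  set M : GL n R := Φ * δ⁻¹ with hM
  set N : GL n R := epsNorm (unitaryTwist σ Φ) δ with hNdef
  -- `M* = M N` and `N* M N = M` at the matrix level
  have hI2 : (((M : GL n R) : Matrix n n R).map σ)ᵀ = ((M * N : GL n R) : Matrix n n R) := by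
    rw [← coe_inv_glTransposeInv_map, hM, hNdef, inv_glTransposeInv_map_formMul σ Φ hΦ δ]
  have hI1 : (((N : GL n R) : Matrix n n R).map σ)ᵀ * ((M : GL n R) : Matrix n n R) * ((N : GL n R) : Matrix n n R) =
      ((M : GL n R) : Matrix n n R) := by
    rw [← coe_inv_glTransposeInv_map, ← Units.val_mul, ← Units.val_mul, hM, hNdef, inv_glTransposeInv_map_epsNorm_mul σ Φ hσ hΦ δ]
  -- conjugate transpose of the scalar factor
  have hQ : ((c • (1 : Matrix n n R) + σ c • ((N : GL n R) : Matrix n n R)).map σ)ᵀ =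
      σ c • (1 : Matrix n n R) + c • (((N : GL n R) : Matrix n n R).map σ)ᵀ := by
    ext i j
    simp only [Matrix.transpose_apply, Matrix.map_apply, Matrix.add_apply, Matrix.smul_apply, Matrix.one_apply, smul_eq_mul, map_add,
      map_mul, hσ, mul_ite, mul_one, mul_zero, apply_ite σ, map_zero, eq_comm]
  rw [Matrix.map_mul, Matrix.transpose_mul, hQ, hI2, Units.val_mul, Matrix.add_mul, Matrix.smul_mul, Matrix.smul_mul, Matrix.one_mul,
    ← Matrix.mul_assoc, hI1, Matrix.mul_add, Matrix.mul_smul, Matrix.mul_smul, Matrix.mul_one, add_comm]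

/-- **`N(δ)` PRESERVES the hermitian form `Ψ_c`**: `N(δ) ∈ U(σ, Ψ_c) = {g : (σg)ᵀ Ψ_c g = Ψ_c}` (★ `unitaryGroupOfForm`) for every scalar `c` — (I1) and the fact
that `c·1 + σ(c)·N(δ)` commutes with `N(δ)`. [cite: Rogawski1990, §3.11 Prop. 3.11.1 (a)(c) p. 34] [cite: PlatonovRapinchuk1994, §2.3] -/
theorem epsNorm_mem_unitaryGroupOfForm_normForm (hσ : ∀ x, σ (σ x) = x) (hΦ : (((Φ : GL n R) : Matrix n n R).map σ)ᵀ = Φ) (δ : GL n R) (c : R) :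
    epsNorm (unitaryTwist σ Φ) δ ∈ unitaryGroupOfForm σ
      (((Φ * δ⁻¹ : GL n R) : Matrix n n R) *
        (c • (1 : Matrix n n R) + σ c • ((epsNorm (unitaryTwist σ Φ) δ : GL n R) : Matrix n n R))) := by
  set M : GL n R := Φ * δ⁻¹ with hM
  set N : GL n R := epsNorm (unitaryTwist σ Φ) δ with hNdef
  have hI1 : (((N : GL n R) : Matrix n n R).map σ)ᵀ * ((M : GL n R) : Matrix n n R) * ((N : GL n R) : Matrix n n R) =
      ((M : GL n R) : Matrix n n R) := by
    rw [← coe_inv_glTransposeInv_map, ← Units.val_mul, ← Units.val_mul, hM, hNdef, inv_glTransposeInv_map_epsNorm_mul σ Φ hσ hΦ δ]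
  have hcomm : (c • (1 : Matrix n n R) + σ c • ((N : GL n R) : Matrix n n R)) * ((N : GL n R) : Matrix n n R) =
      ((N : GL n R) : Matrix n n R) * (c • (1 : Matrix n n R) + σ c • ((N : GL n R) : Matrix n n R)) := by
    rw [Matrix.add_mul, Matrix.mul_add, Matrix.smul_mul, Matrix.mul_smul, Matrix.one_mul, Matrix.mul_one, Matrix.smul_mul, Matrix.mul_smul]
  rw [mem_unitaryGroupOfForm_iff, Matrix.mul_assoc, Matrix.mul_assoc, hcomm, ← Matrix.mul_assoc, ← Matrix.mul_assoc, hI1]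

end Generic

/-! ## §2 Over a field of characteristic zero: some `c` makes `c·1 + σ(c)·A` invertible -/

section FieldStep

variable {K : Type*} [Field K] [CharZero K] (σ : K →+* K)

/-- **For `A ∈ M₃(K)` over a field `K` of characteristic `0` with an endomorphism `σ` moving some `θ ≠ 0` to `−θ`, some scalar `c` makes
`c·1 + σ(c)·A` invertible.**  The scalars `c_k = k + θ` (`k = 0, 1, 2, 3`) have pairwise distinct ratios `t_k = −c_k∕σ(c_k) = −(k + θ)∕(k − θ)`
(`t_k = t_l ⇒ 2θ(l − k) = 0`), and `det(c_k·1 + σ(c_k)·A) = (−σ c_k)³ · χ_A(t_k)` (Mathlib `Matrix.eval_charpoly`); the cubic `χ_A` cannot vanish at four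
points (`Polynomial.eq_zero_of_natDegree_lt_card_of_eval_eq_zero`). [cite: Rogawski1990, §3.11 p. 34] -/
theorem exists_det_add_smul_ne_zero {θ : K} (hθ : σ θ = -θ) (hθ0 : θ ≠ 0) (A : Matrix (Fin 3) (Fin 3) K) :
    ∃ c : K, (c • (1 : Matrix (Fin 3) (Fin 3) K) + σ c • A).det ≠ 0 := by
  classical
  have h2 : (2 : K) ≠ 0 := two_ne_zero
  have hnat : ∀ k : ℕ, σ (k : K) = k := fun k => map_natCast σ k
  -- `k - θ ≠ 0` (else `σ` would fix `θ`)
  have hden : ∀ k : ℕ, (k : K) - θ ≠ 0 := by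
    intro k hk
    have hkθ : θ = k := (sub_eq_zero.1 hk).symm
    have hfix : σ θ = θ := by rw [hkθ, hnat]
    rw [hθ, neg_eq_iff_add_eq_zero, ← two_mul] at hfix
    exact mul_ne_zero h2 hθ0 hfix
  -- the four ratios `t_k = -(k + θ)/(k - θ)` are pairwise distinct
  set t : Fin 4 → K := fun k => -(((k : ℕ) : K) + θ) / (((k : ℕ) : K) - θ) with htdef
  have ht_inj : Function.Injective t := by
    intro k l hkl
    simp only [htdef] at hkl
    rw [div_eq_div_iff (hden k) (hden l)] at hkl
    have hkl' : (2 : K) * θ * (((l : ℕ) : K) - ((k : ℕ) : K)) = 0 := by linear_combination (-1 : K) * hkl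
    rcases mul_eq_zero.1 hkl' with h | h
    · exact absurd h (mul_ne_zero h2 hθ0)
    · exact Fin.ext (Nat.cast_injective (R := K) (sub_eq_zero.1 h)).symm
  -- if all four determinants vanished, the cubic `χ_A` would have four roots
  by_contra hall
  rw [not_exists] at hall
  have heval : ∀ k : Fin 4, A.charpoly.eval (t k) = 0 := by
    intro k
    have hk : (((k : ℕ) : K)) - θ ≠ 0 := hden k
    have hσc : σ ((((k : ℕ) : K)) + θ) = ((k : ℕ) : K) - θ := by rw [map_add, hnat, hθ, ← sub_eq_add_neg]
    have hdet : (((((k : ℕ) : K)) + θ) • (1 : Matrix (Fin 3) (Fin 3) K) + σ ((((k : ℕ) : K)) + θ) • A).det = 0 := by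
      have h := hall ((((k : ℕ) : K)) + θ)
      rwa [not_not] at h
    have hcoef : -(((k : ℕ) : K) - θ) * t k = ((k : ℕ) : K) + θ := by
      simp only [htdef]
      field_simp
    -- `c·1 + σ(c)·A = (-σ c) • (t_k·1 - A)`
    have hQ : ((((k : ℕ) : K)) + θ) • (1 : Matrix (Fin 3) (Fin 3) K) + σ ((((k : ℕ) : K)) + θ) • A =
        (-(((k : ℕ) : K) - θ)) • (Matrix.scalar (Fin 3) (t k) - A) := by
      rw [hσc, Matrix.scalar_apply, ← Matrix.smul_one_eq_diagonal, smul_sub, smul_smul, hcoef, neg_smul, sub_neg_eq_add]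
    rw [hQ, Matrix.det_smul, Fintype.card_fin, ← Matrix.eval_charpoly] at hdet
    rcases mul_eq_zero.1 hdet with h | h
    · exact absurd ((pow_eq_zero_iff (by norm_num)).1 h) (neg_ne_zero.2 hk)
    · exact h
  have hzero : A.charpoly = 0 :=
    Polynomial.eq_zero_of_natDegree_lt_card_of_eval_eq_zero A.charpoly ht_inj heval
      (by rw [Matrix.charpoly_natDegree_eq_dim, Fintype.card_fin, Fintype.card_fin]; norm_num)
  exact (Matrix.charpoly_monic A).ne_zero hzero

end FieldStep

/-! ## §3 THE HEADS: every `δ ∈ G̃_v` has a norm in `U(Φ₃)(L⁺_v)` at a non-split place -/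

section CM

variable (L : Type) [Field L] [NumberField L] [IsCMField L] (v : HeightOneSpectrum (𝓞 ↥(maximalRealSubfield L)))

/-- The local split form `Φ₃ ⊗ 1` is `σ_v`-hermitian (its entries are `0, 1`). [cite: Rogawski1990, §12.2 p. 171; §1.9 p. 8] -/
theorem formLocal_splitFormGL_isHermitian :
    (((formLocal L 3 (splitFormGL L) v : GL (Fin 3) (LocalRing L v)) : Matrix (Fin 3) (Fin 3) (LocalRing L v)).map
        (conjLocal L (IsCMField.complexConj L) v))ᵀ =
      ((formLocal L 3 (splitFormGL L) v : GL (Fin 3) (LocalRing L v)) : Matrix (Fin 3) (Fin 3) (LocalRing L v)) := by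
  refine Matrix.ext fun i j => ?_
  change conjLocal L (IsCMField.complexConj L) v (algebraMap L (LocalRing L v) (splitForm L 3 j i)) = algebraMap L (LocalRing L v) (splitForm L 3 i j)
  rw [conjLocal_algebraMap]
  fin_cases i <;> fin_cases j <;> simp [splitForm]

omit [IsCMField L] in
/-- The local split form read over `L ⊗ L⁺_v` is the literal antidiagonal unit form (entrywise `algebraMap` of `0, 1`). [cite: Rogawski1990, §12.2 p. 171] -/
theorem splitForm_three_map_algebraMap :
    (splitForm L 3).map (algebraMap L (LocalRing L v)) =
      Matrix.of fun i j : Fin 3 => if i.val + j.val + 1 = 3 then (1 : LocalRing L v) else 0 := by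
  refine Matrix.ext fun i j => ?_
  fin_cases i <;> fin_cases j <;> simp [splitForm]

/-- **(NORM-RAT, strong form) At a NON-SPLIT place `v`, EVERY `δ ∈ G̃_v = GL₃(L ⊗ L⁺_v)` has a norm in the quasi-split `U(Φ₃)(L⁺_v)`**: there is
`γ ∈ (cmDatum L 3 Φ₃).Local v` with `N(δ) = δ ε_v(δ)` conjugate to `γ` in `G̃_v` (★ `IsEpsNormPair`).  Proof: §1 puts `N(δ)` in the unitary group of the
hermitian form `Ψ_c = Φ δ⁻¹(c + σ(c) N(δ))`, §2 picks `c` with `Ψ_c` non-degenerate, ★ Jacobowitz (`exists_isUnit_formCongr_eq_smul_antidiag_three`) writes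
`ᵗ(σT) Ψ_c T = a·Φ₃` with `a` a unit, and `γ := T⁻¹ N(δ) T ∈ U(a·Φ₃) = U(Φ₃)`.  Print: Prop. 3.11.1 (a)∕(c) («the norm map defines a bijection between
`𝒪_{ε-st}(G̃)` and `𝒪_{st}(G)`»; existence via Thm. 3.2.1). [cite: Rogawski1990, §3.11 Prop. 3.11.1 (a)(c) p. 34; §3.2 Thm. 3.2.1 p. 20] [cite: Jacobowitz1962, §3 Thm. 3.1] -/
theorem exists_isEpsNormPair_splitFormGL (hns : ∀ w : PlacesOver L v, IsCMField.complexConj L • w.1 = w.1) (δ : GtLoc L v) :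
    ∃ γ : (UnitaryGroup.cmDatum L 3 (splitFormGL L : Matrix (Fin 3) (Fin 3) L)).Local v, IsEpsNormPair L (splitFormGL L) v δ γ := by
  classical
  -- data of the non-split place
  obtain ⟨e, he⟩ : ∃ e : L, IsCMField.complexConj L e ≠ e := by
    by_contra h
    exact IsCMField.complexConj_ne_one L (AlgEquiv.ext fun x => not_ne_iff.mp (not_exists.mp h x))
  set δ₀ : L := e - IsCMField.complexConj L e with hδ₀def
  have hcδ : IsCMField.complexConj L δ₀ = -δ₀ := by
    rw [hδ₀def, map_sub, IsCMField.complexConj_apply_apply, neg_sub]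
  have hδ0 : δ₀ ≠ 0 := sub_ne_zero.2 (Ne.symm he)
  obtain ⟨w⟩ : Nonempty (PlacesOver L v) := inferInstance
  have hw : IsCMField.complexConj L • w.1 = w.1 := hns w
  haveI : Algebra.IsQuadraticExtension ↥(maximalRealSubfield L) L := IsCMField.isQuadraticExtension L
  have hσ : ∀ x, conjLocal L (IsCMField.complexConj L) v (conjLocal L (IsCMField.complexConj L) v x) = x :=
    Liu2021.LemD1OfPlace.conjLocal_conjLocal_apply L v (IsCMField.complexConj L) hcδ hδ0
  -- the objects: `Φ = Φ₃ ⊗ 1`, `N = N(δ)`, `M = Φ δ⁻¹`, the scalar `c`, the form `Ψ`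
  set σ := conjLocal L (IsCMField.complexConj L) v with hσdef
  set Φ : GL (Fin 3) (LocalRing L v) := formLocal L 3 (splitFormGL L) v with hΦdef
  have hΦh : (((Φ : GL (Fin 3) (LocalRing L v)) : Matrix (Fin 3) (Fin 3) (LocalRing L v)).map σ)ᵀ = Φ :=
    formLocal_splitFormGL_isHermitian L v
  set N : GL (Fin 3) (LocalRing L v) := epsNorm (unitaryTwist σ Φ) δ with hNdef
  have hNε : epsNorm (epsLoc L (splitFormGL L) v) δ = N := rfl
  -- §2 over the field `K = L ⊗ L⁺_v`: a scalar `c` with `c·1 + σ(c)·N` invertible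
  obtain ⟨c, hc⟩ : ∃ c : LocalRing L v, IsUnit (c • (1 : Matrix (Fin 3) (Fin 3) (LocalRing L v)) + σ c • N.val).det := by
    letI : Field (LocalRing L v) :=
      (Liu2021.LemD1IndexedNonVacuityNonsplitPlace.isField_localRing_of_nonsplit L v (IsCMField.complexConj L) hcδ hδ0 w hw).toField
    haveI : CharZero (LocalRing L v) := charZero_of_injective_algebraMap (algebraMap L (LocalRing L v)).injective
    have hθ : σ (algebraMap L (LocalRing L v) δ₀) = -algebraMap L (LocalRing L v) δ₀ := by
      rw [hσdef, conjLocal_algebraMap, hcδ, map_neg]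
    have hθ0 : algebraMap L (LocalRing L v) δ₀ ≠ 0 := (_root_.map_ne_zero _).2 hδ0
    obtain ⟨c, hc⟩ := exists_det_add_smul_ne_zero σ hθ hθ0 N.val
    exact ⟨c, isUnit_iff_ne_zero.2 hc⟩
  set Ψ : Matrix (Fin 3) (Fin 3) (LocalRing L v) := (Φ * δ⁻¹).val * (c • (1 : Matrix (Fin 3) (Fin 3) (LocalRing L v)) + σ c • N.val)
    with hΨdef
  have hΨh : (Ψ.map σ)ᵀ = Ψ := normForm_isHermitian σ Φ hσ hΦh δ c
  have hΨd : IsUnit Ψ.det := by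
    rw [hΨdef, Matrix.det_mul]
    exact ((Matrix.isUnit_iff_isUnit_det _).1 (Units.isUnit _)).mul hc
  have hNΨ : N ∈ unitaryGroupOfForm σ Ψ := epsNorm_mem_unitaryGroupOfForm_normForm σ Φ hσ hΦh δ c
  -- Jacobowitz: `Ψ ≅ a • Φ₃`
  obtain ⟨T, a, ha, -, hT⟩ :=
    exists_isUnit_formCongr_eq_smul_antidiag_three L v (IsCMField.complexConj L) hcδ hδ0 w hw hΨh hΨd
  -- `γ := T⁻¹ N T ∈ U(a • Φ₃) = U(Φ₃)`
  have hγmem : T⁻¹ * N * T ∈ unitaryGroupOfForm σ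
      (Matrix.of fun i j : Fin 3 => if i.val + j.val + 1 = 3 then (1 : LocalRing L v) else 0) := by
    rw [← unitaryGroupOfForm_smul_of_isUnit σ ha]
    exact ((unitaryGroupOfFormCongrOfEq σ T Ψ _ hT).symm ⟨N, hNΨ⟩).2
  have hγloc : T⁻¹ * N * T ∈ «local» L (IsCMField.complexConj L) 3 (splitFormGL L : Matrix (Fin 3) (Fin 3) L) v := by
    rw [local_eq_unitaryGroupOfForm_map, coe_splitFormGL, splitForm_three_map_algebraMap L v]
    exact hγmem
  refine ⟨⟨T⁻¹ * N * T, hγloc⟩, ?_⟩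
  rw [isEpsNormPair_iff, hNε]
  exact isConj_iff.2 ⟨T⁻¹, by rw [inv_inv]⟩

/-- **(NORM-RAT, the dealt shape) every ε-REGULAR `δ ∈ G̃_v` has a norm in `U(Φ₃)(L⁺_v)`** at a non-split `v` — R90-C131-p03 (g2)'s named gap A5 of the T-WIF road
(«`∀ δ, IsEpsRegularAt L Φ v δ → ∃ γ : G, IsEpsNormPair L Φ v δ γ`» at `Φ = splitFormGL L`); the ε-regularity hypothesis is not needed (`exists_isEpsNormPair_splitFormGL`).
[cite: Rogawski1990, §3.11 Prop. 3.11.1 (a)(c) p. 34] -/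
theorem exists_isEpsNormPair_of_isEpsRegularAt (hns : ∀ w : PlacesOver L v, IsCMField.complexConj L • w.1 = w.1) :
    ∀ δ : GtLoc L v, IsEpsRegularAt L (splitFormGL L) v δ →
      ∃ γ : (UnitaryGroup.cmDatum L 3 (splitFormGL L : Matrix (Fin 3) (Fin 3) L)).Local v, IsEpsNormPair L (splitFormGL L) v δ γ :=
  fun δ _ => exists_isEpsNormPair_splitFormGL L v hns δ

end CM

end Summit.HodgeConjecture.HodgeConjecture.R90.S4

end
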